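import Summits.QuantumFields.BalabanUV.Beta.GAN24.Lin4LegDivergence

/-!
# `BalabanUV.Beta.GAN24.Lin4LegTower` — binder row G-an2-4 ∕ (CONV-C), CT-W, located crux (Q-L) («QL-LL», RULING R-gan24p1-g25-1 R10 (iii)):
# «(REP-leg)» — THE CLOSED ONE-STEP TOWER OF THE RIGHT-DIVERGENCED KERNEL LEG OF THE LINEAR STEP `lin4` (G-an2-4 formalisation swarm, leaf prover
# `b2b-balaban-gan24-formalise-leaf-03`, gen 60; the OWNER gan24-p1's R10 (iii) «first refusal leaf-03, STATEMENT FIRST, the one-step identity only»; name PROVISIONAL)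

NOT IN PRINT; OUR BOOKKEEPING.  HONEST FRAMING (cell contract, verbatim): «discharging `BetaPertH` makes Bałaban's UV stability
UNCONDITIONAL — a real constructive-QFT result; it is NOT the continuum limit and NOT the Clay problem.»  HONEST DEPENDENCY (verbatim):
«continuum YM on T⁴ ⇐ BetaPertH ∧ nine spine estimates (0/9 proved); BetaPertH ⇐ (D1) ∧ (D4) ∧ CAP+tail; G-an2-4 gates asym, D1 and
NE2/3/4.»

WHAT ([folklore] kernel algebra on leaf-01's bounded-table class, generic `d`, generic blocking `N`, generic decaying `K` with the ℋ-column Ward law (hH)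
(constant `c_H`) and the multiplier row law (hM♯); the engine is this lineage's gen-58 «T-EQ, right leg slot» `Lin4LegDivergence.legDiv_lin4_right_inner`;
four plumbing `def`s so that the (Q-L) rows address ONE typed object; 0 cite, 0 `def … : Prop`, 0 sorry):
* §1 `rdiv F` — the backward divergence `Σ_β (F x (p − e_β) a (inl β) − F x p a (inl β))` of the right FIELD leg of a kernel, the former right site kept as a
  POSITION index `p` in the `z`-slot (constant in the dummy fibre index); `bsum N F` — the block sum `Σ_{v ∈ box} F x (N•y + v) a b` of the position index
  (R10's `𝔹`); `mreadL N F` — the left leg read at the coarse multiplier point `(N•x′, inr α)` (field rows only); `legStep kc G K N W s := kc • mreadL N (K ∘ vsym G N W s)`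
  (R10's `𝓛_j` with `kc = −(c·c_H)`, `G = K`: slots through leaf-04's `vsym`, the left leg through ONE `K`-row, the position index untouched); algebra, `Bdd`.
* §2 **LEGS PASS THROUGH `vsym`** (idea-1 WARD6 v1.2 (9.1), the one new lemma of (REP-leg)): `wsum`, `vertexOfK`, `vertex2OfK`, `vsym` commute with `rdiv` and
  with `bsum` on bounded tables for a decaying `K` (the chain-rule vertex acts on the SLOTS; finite leg sums∕differences go through the absolutely convergent
  `u`-series); §3 `comp K (rdiv W) = rdiv (comp K W)`, `comp K (bsum N W) = bsum N (comp K W)` (slices summable).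
* §4 **THE CLOSED ONE-STEP IDENTITY** `rdiv (lin4 c K N T s) = legStep (−(c·c_H)) K K N (fun s ↦ bsum N (rdiv (T s))) s` and its affine form with a source `F`:
  `rdiv ((lin4 c K N T + F) s) = legStep … s + rdiv (F s)` — R10 (iii)'s `Δ_{j+1} = 𝓛_j(𝔹 Δ_j) + D^R F_j` BY NAME, no cross terms.
* §5 `𝔹` COMMUTES WITH `𝓛`: `bsum N′ (legStep kc G K N W s) = legStep kc G K N (fun s ↦ bsum N′ (W s)) s`; `legStep` is additive on bounded tables.
* §6 THE COMB ∕ WALL INSTANCE `K♮ᴱ_j = unitK (sfStep Lc j) (smStep d Lc j) (coDressKBmAt (toSite r) Lc (KInvStep Lc j))`, `N = Lc`, `c_H = (Lc^{d+1})⁻¹`, every `j`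
  and in-block root (gen-58 `hH_unitK_comb` ∕ `hM_unitK_comb`) — the DRESSED chain of WARD6 (9.2).
Asserts NO norm of `𝓛_j` or of a k₀-fold chain ((WIN-k₀)), nothing of (LAY-leg)∕(LT-leg)∕(GRON-k₀), and NOT the inequality (Q-L-k₀) — OPEN, the content of (Q-L);
discharges NOTHING of (Q-L) ∕ (Q-R) ∕ (C) ∕ «T2Shape» ∕ «T2Drift» ∕ (hW, hWall); 0 wall binders; NEVER «G-an2-4 closed» as (CONV-C); NOT D1, NOT `BetaPertH`,
NOT continuum, NOT Clay; not in print.  Unit `b2b-balaban-gan24-formalise-leaf-03` (gen 60), 2026-08-22.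
-/

noncomputable section
open Finset
open scoped BigOperators
open Literature.MathematicalPhysics.QuantumFieldTheory
open Literature.MathematicalPhysics.QuantumFieldTheory.Balaban1983to89
open Literature.MathematicalPhysics.QuantumFieldTheory.Balaban1983to89.Beta
open B6BondElimination (unitVec)
open ExpKernelCalculus (MKer Site Decays comp summable_exp_shift')
open OneStepResolventKernel (Fib wsum)
open OneStepKernelFamily (colH vertexOfK KInvStep abs_colH_le)
open SecondOrderResponse (vertex2OfK)
open BalabanStepJetsSucc (mmRead mmRead_inl_inl mmRead_inr_left)
open KernelWard (Bdd)
open AffineAveraging (box toSite)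
open Summit.QuantumFields.BalabanUV.Beta.KernelWardRelative (gaugeWt)
open Summit.QuantumFields.BalabanUV.Beta.GAN24.T2RecursionAffine (vsym lin4 lin4_apply)
open Summit.QuantumFields.BalabanUV.Beta.GAN24.Lin4Additive (abs_vertexOfK_le abs_vsym_le summable_slices_decays_bdd vsym_add)
open Summit.QuantumFields.BalabanUV.Beta.ChartConjugationReflection (vertexOfK_eq_sum summable_abs_colH)
open Summit.QuantumFields.BalabanUV.Beta.HessKerDressedUnits (unitK decays_unitK)
open Summit.QuantumFields.BalabanUV.Beta.GAN24.CombesThomas (sfStep smStep)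
open Summit.QuantumFields.BalabanUV.Beta.AxialDressingRooted (coDressKBmAt one_le_of_neZero decays_coDressKBmAt_KInvStep)
open Summit.QuantumFields.BalabanUV.Beta.GAN24.Lin4SlotDivergence (hH_unitK_comb)
open Summit.QuantumFields.BalabanUV.Beta.GAN24.Lin4LegDivergence (legDiv_lin4_right_inner hM_unitK_comb)
open StepJetData (comp_add_right)

namespace Summit.QuantumFields.BalabanUV.Beta.GAN24.Lin4LegTower

variable {d : ℕ}

/-! ## §1 Plumbing: the right-leg divergence with a position index, the block sum of the position index, the left coarse read, the one-step leg map -/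

/-- [folklore] Plumbing `def`: **THE BACKWARD DIVERGENCE OF THE RIGHT FIELD LEG**, the former right site kept as a POSITION index `p` (in the `z`-slot),
constant in the dummy right fibre index: `rdiv F x p a _ := Σ_β (F x (p − e_β) a (inl β) − F x p a (inl β))`. -/
def rdiv (F : MKer (d + 1) (Fib d)) : MKer (d + 1) (Fib d) :=
  fun x p a _ => ∑ β, (F x (p - unitVec β) a (Sum.inl β) - F x p a (Sum.inl β))

/-- [folklore] Plumbing `def`: **THE BLOCK SUM OF THE POSITION INDEX** (R10's `𝔹`): `bsum N F x y a b := Σ_{v ∈ box} F x (N•y + toSite v) a b`. -/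
def bsum (N : ℕ) (F : MKer (d + 1) (Fib d)) : MKer (d + 1) (Fib d) :=
  fun x y a b => ∑ v ∈ box (d + 1) N, F x ((N : ℤ) • y + toSite v) a b

/-- [folklore] Plumbing `def`: **THE LEFT LEG READ AT THE COARSE MULTIPLIER POINT** — `mreadL N F x′ y (inl α) b := F (N•x′) y (inr α) b`, no multiplier rows. -/
def mreadL (N : ℕ) (F : MKer (d + 1) (Fib d)) : MKer (d + 1) (Fib d) :=
  fun x' y a b =>
    match a with
    | Sum.inl α => F ((N : ℤ) • x') y (Sum.inr α) b
    | Sum.inr _ => 0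

/-- [folklore] Plumbing `def`: **THE ONE-STEP LEG MAP** (R10 (iii)'s `𝓛_j`, WARD6 (9.1)): `legStep kc G K N W s := kc • mreadL N (K ∘ vsym G N W s)` — the SLOTS of the
table `W` go through leaf-04's symmetrised bi-vertex `vsym` with the ℋ-columns of `G`, the LEFT leg is read through ONE row of `K` at the coarse multiplier point,
the position index (right slot) is untouched.  For the right leg of `lin4 c K N`: `kc = −(c·c_H)`, `G = K` (§4); for the left leg the transposed data enter. -/
def legStep (kc : ℝ) (G K : MKer (d + 1) (Fib d)) (N : ℕ)
    (W : Fin (d + 1) → (Fin (d + 1) → ℤ) → Fin (d + 1) → (Fin (d + 1) → ℤ) → MKer (d + 1) (Fib d))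
    (κ : Fin (d + 1)) (u : Fin (d + 1) → ℤ) (κ' : Fin (d + 1)) (u' : Fin (d + 1) → ℤ) : MKer (d + 1) (Fib d) :=
  kc • mreadL N (comp K (vsym G N W κ u κ' u'))

/-- [folklore] The entries of `rdiv`. -/
@[simp] theorem rdiv_apply (F : MKer (d + 1) (Fib d)) (x p : Site (d + 1)) (a b : Fib d) :
    rdiv F x p a b = ∑ β, (F x (p - unitVec β) a (Sum.inl β) - F x p a (Sum.inl β)) := rfl

/-- [folklore] The entries of `bsum`. -/
@[simp] theorem bsum_apply (N : ℕ) (F : MKer (d + 1) (Fib d)) (x y : Site (d + 1)) (a b : Fib d) :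
    bsum N F x y a b = ∑ v ∈ box (d + 1) N, F x ((N : ℤ) • y + toSite v) a b := rfl

/-- [folklore] The field rows of the one-step leg map: `kc · (K ∘ vsym G N W s) (N•x′) y (inr α) b`. -/
theorem legStep_inl (kc : ℝ) (G K : MKer (d + 1) (Fib d)) (N : ℕ)
    (W : Fin (d + 1) → (Fin (d + 1) → ℤ) → Fin (d + 1) → (Fin (d + 1) → ℤ) → MKer (d + 1) (Fib d))
    (κ : Fin (d + 1)) (u : Fin (d + 1) → ℤ) (κ' : Fin (d + 1)) (u' : Fin (d + 1) → ℤ) (x' y : Site (d + 1)) (α : Fin (d + 1)) (b : Fib d) :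
    legStep kc G K N W κ u κ' u' x' y (Sum.inl α) b = kc * comp K (vsym G N W κ u κ' u') ((N : ℤ) • x') y (Sum.inr α) b := rfl

/-- [folklore] The one-step leg map has no multiplier rows. -/
theorem legStep_inr (kc : ℝ) (G K : MKer (d + 1) (Fib d)) (N : ℕ)
    (W : Fin (d + 1) → (Fin (d + 1) → ℤ) → Fin (d + 1) → (Fin (d + 1) → ℤ) → MKer (d + 1) (Fib d))
    (κ : Fin (d + 1)) (u : Fin (d + 1) → ℤ) (κ' : Fin (d + 1)) (u' : Fin (d + 1) → ℤ) (x' y : Site (d + 1)) (ρ : Fin (d + 1)) (b : Fib d) :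
    legStep kc G K N W κ u κ' u' x' y (Sum.inr ρ) b = 0 := mul_zero kc

/-- [folklore] `rdiv` is additive. -/
theorem rdiv_add (F G : MKer (d + 1) (Fib d)) : rdiv (F + G) = rdiv F + rdiv G := by
  funext x p a b
  simp only [rdiv_apply, Pi.add_apply, ← Finset.sum_add_distrib]
  exact Finset.sum_congr rfl fun β _ => by ring

/-- [folklore] `rdiv` is homogeneous. -/
theorem rdiv_smul (r : ℝ) (F : MKer (d + 1) (Fib d)) : rdiv (r • F) = r • rdiv F := by
  funext x p a b
  simp only [rdiv_apply, Pi.smul_apply, smul_eq_mul, Finset.mul_sum]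
  exact Finset.sum_congr rfl fun β _ => by ring

/-- [folklore] `rdiv` of a finite sum. -/
theorem rdiv_finset_sum {ι : Type*} (s : Finset ι) (F : ι → MKer (d + 1) (Fib d)) :
    rdiv (∑ i ∈ s, F i) = ∑ i ∈ s, rdiv (F i) := by
  classical
  induction s using Finset.induction_on with
  | empty =>
    funext x p a b
    simp [rdiv]
  | @insert i s hi ih => rw [Finset.sum_insert hi, Finset.sum_insert hi, rdiv_add, ih]

/-- [folklore] `bsum` is additive. -/
theorem bsum_add (N : ℕ) (F G : MKer (d + 1) (Fib d)) : bsum N (F + G) = bsum N F + bsum N G := by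
  funext x y a b
  simp only [bsum_apply, Pi.add_apply, Finset.sum_add_distrib]

/-- [folklore] `bsum` is homogeneous. -/
theorem bsum_smul (N : ℕ) (r : ℝ) (F : MKer (d + 1) (Fib d)) : bsum N (r • F) = r • bsum N F := by
  funext x y a b
  simp only [bsum_apply, Pi.smul_apply, smul_eq_mul, Finset.mul_sum]

/-- [folklore] `bsum` of a finite sum. -/
theorem bsum_finset_sum (N : ℕ) {ι : Type*} (s : Finset ι) (F : ι → MKer (d + 1) (Fib d)) :
    bsum N (∑ i ∈ s, F i) = ∑ i ∈ s, bsum N (F i) := by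
  classical
  induction s using Finset.induction_on with
  | empty =>
    funext x y a b
    simp [bsum]
  | @insert i s hi ih => rw [Finset.sum_insert hi, Finset.sum_insert hi, bsum_add, ih]

/-- [folklore] `rdiv` of a bounded kernel is bounded (constant `(d+1)·(B+B)`). -/
theorem bdd_rdiv {F : MKer (d + 1) (Fib d)} {B : ℝ} (hF : Bdd F B) : Bdd (rdiv F) (((d + 1 : ℕ) : ℝ) * (B + B)) := by
  intro x p a b
  rw [rdiv_apply]
  calc |∑ β, (F x (p - unitVec β) a (Sum.inl β) - F x p a (Sum.inl β))|
      ≤ ∑ β, |F x (p - unitVec β) a (Sum.inl β) - F x p a (Sum.inl β)| := Finset.abs_sum_le_sum_abs _ _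
    _ ≤ ∑ _β : Fin (d + 1), (B + B) := Finset.sum_le_sum fun β _ =>
        (abs_sub _ _).trans (add_le_add (hF _ _ _ _) (hF _ _ _ _))
    _ = ((d + 1 : ℕ) : ℝ) * (B + B) := by rw [Finset.sum_const, Finset.card_univ, Fintype.card_fin, nsmul_eq_mul]

/-! ## §2 Legs pass through `wsum`, `vertexOfK`, `vertex2OfK`, `vsym` -/

section PassThrough

/-- [folklore] **`wsum` COMMUTES WITH `rdiv`** (absolutely summable weight, bounded family): the weighted superposition acts on the family index, the
divergence on the legs. -/
theorem wsum_rdiv {w : Site (d + 1) → ℝ} (hw : Summable fun u => |w u|) {S : Site (d + 1) → MKer (d + 1) (Fib d)} {B : ℝ}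
    (hS : ∀ u x z a b, |S u x z a b| ≤ B) : wsum w (fun u => rdiv (S u)) = rdiv (wsum w S) := by
  funext x p a b
  have hs : ∀ (z : Site (d + 1)) (b' : Fib d), Summable fun u => w u * S u x z a b' := fun z b' =>
    Summable.of_norm_bounded (hw.mul_right B) (fun u => by
      rw [Real.norm_eq_abs, abs_mul]; exact mul_le_mul_of_nonneg_left (hS u x z a b') (abs_nonneg _))
  simp only [wsum, rdiv_apply, Finset.mul_sum, mul_sub]
  rw [Summable.tsum_finsetSum (fun β _ => (hs _ _).sub (hs _ _))]
  exact Finset.sum_congr rfl fun β _ => (hs _ _).tsum_sub (hs _ _)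

/-- [folklore] **`wsum` COMMUTES WITH `bsum`**. -/
theorem wsum_bsum (N : ℕ) {w : Site (d + 1) → ℝ} (hw : Summable fun u => |w u|) {S : Site (d + 1) → MKer (d + 1) (Fib d)} {B : ℝ}
    (hS : ∀ u x z a b, |S u x z a b| ≤ B) : wsum w (fun u => bsum N (S u)) = bsum N (wsum w S) := by
  funext x y a b
  have hs : ∀ (z : Site (d + 1)), Summable fun u => w u * S u x z a b := fun z =>
    Summable.of_norm_bounded (hw.mul_right B) (fun u => by
      rw [Real.norm_eq_abs, abs_mul]; exact mul_le_mul_of_nonneg_left (hS u x z a b) (abs_nonneg _))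
  simp only [wsum, bsum_apply, Finset.mul_sum]
  exact Summable.tsum_finsetSum (fun v _ => hs _)

variable {K : MKer (d + 1) (Fib d)} {C δ : ℝ}

/-- [folklore] **THE CHAIN-RULE VERTEX COMMUTES WITH `rdiv`** (decaying `K`, bounded family). -/
theorem vertexOfK_rdiv (hK : Decays K C δ) (hδ : 0 < δ) (N : ℕ) {S : Fin (d + 1) → (Fin (d + 1) → ℤ) → MKer (d + 1) (Fib d)} {B : ℝ}
    (hS : ∀ κ u x z a b, |S κ u x z a b| ≤ B) (μ : Fin (d + 1)) (y : Fin (d + 1) → ℤ) :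
    vertexOfK K N (fun κ u => rdiv (S κ u)) μ y = rdiv (vertexOfK K N S μ y) := by
  have hKex : ∃ δ C : ℝ, 0 < δ ∧ 0 ≤ C ∧ Decays K C δ := ⟨δ, C, hδ, hK.nonneg (Sum.inl 0), hK⟩
  rw [vertexOfK_eq_sum, vertexOfK_eq_sum, rdiv_finset_sum]
  exact Finset.sum_congr rfl fun κ' _ => wsum_rdiv (summable_abs_colH (N := N) hKex μ y κ') (hS κ')

/-- [folklore] **THE CHAIN-RULE VERTEX COMMUTES WITH `bsum`**. -/
theorem vertexOfK_bsum (hK : Decays K C δ) (hδ : 0 < δ) (N N' : ℕ) {S : Fin (d + 1) → (Fin (d + 1) → ℤ) → MKer (d + 1) (Fib d)} {B : ℝ}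
    (hS : ∀ κ u x z a b, |S κ u x z a b| ≤ B) (μ : Fin (d + 1)) (y : Fin (d + 1) → ℤ) :
    vertexOfK K N (fun κ u => bsum N' (S κ u)) μ y = bsum N' (vertexOfK K N S μ y) := by
  have hKex : ∃ δ C : ℝ, 0 < δ ∧ 0 ≤ C ∧ Decays K C δ := ⟨δ, C, hδ, hK.nonneg (Sum.inl 0), hK⟩
  rw [vertexOfK_eq_sum, vertexOfK_eq_sum, bsum_finset_sum]
  exact Finset.sum_congr rfl fun κ' _ => wsum_bsum N' (summable_abs_colH (N := N) hKex μ y κ') (hS κ')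

variable {T : Fin (d + 1) → (Fin (d + 1) → ℤ) → Fin (d + 1) → (Fin (d + 1) → ℤ) → MKer (d + 1) (Fib d)} {B : ℝ}

/-- [folklore] **THE BI-VERTEX COMMUTES WITH `rdiv`** (two applications of `vertexOfK_rdiv`, the inner family bounded by leaf-01's `abs_vertexOfK_le`). -/
theorem vertex2OfK_rdiv (hK : Decays K C δ) (hδ : 0 < δ) (N : ℕ) (hT : ∀ κ u κ' u' x z a b, |T κ u κ' u' x z a b| ≤ B)
    (μ : Fin (d + 1)) (y : Fin (d + 1) → ℤ) (ν : Fin (d + 1)) (y' : Fin (d + 1) → ℤ) :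
    vertex2OfK K N (fun κ u κ' u' => rdiv (T κ u κ' u')) μ y ν y' = rdiv (vertex2OfK K N T μ y ν y') := by
  show vertexOfK K N (fun κ u => vertexOfK K N (fun κ' u' => rdiv (T κ u κ' u')) ν y') μ y
    = rdiv (vertexOfK K N (fun κ u => vertexOfK K N (T κ u) ν y') μ y)
  have hin : (fun κ u => vertexOfK K N (fun κ' u' => rdiv (T κ u κ' u')) ν y') = fun κ u => rdiv (vertexOfK K N (T κ u) ν y') := by
    funext κ u
    exact vertexOfK_rdiv hK hδ N (hT κ u) ν y'
  rw [hin]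
  exact vertexOfK_rdiv hK hδ N (S := fun κ u => vertexOfK K N (T κ u) ν y')
    (fun κ u x z a b => abs_vertexOfK_le hK hδ N (hT κ u) ν y' x z a b) μ y

/-- [folklore] **THE BI-VERTEX COMMUTES WITH `bsum`**. -/
theorem vertex2OfK_bsum (hK : Decays K C δ) (hδ : 0 < δ) (N N' : ℕ) (hT : ∀ κ u κ' u' x z a b, |T κ u κ' u' x z a b| ≤ B)
    (μ : Fin (d + 1)) (y : Fin (d + 1) → ℤ) (ν : Fin (d + 1)) (y' : Fin (d + 1) → ℤ) :
    vertex2OfK K N (fun κ u κ' u' => bsum N' (T κ u κ' u')) μ y ν y' = bsum N' (vertex2OfK K N T μ y ν y') := by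
  show vertexOfK K N (fun κ u => vertexOfK K N (fun κ' u' => bsum N' (T κ u κ' u')) ν y') μ y
    = bsum N' (vertexOfK K N (fun κ u => vertexOfK K N (T κ u) ν y') μ y)
  have hin : (fun κ u => vertexOfK K N (fun κ' u' => bsum N' (T κ u κ' u')) ν y') = fun κ u => bsum N' (vertexOfK K N (T κ u) ν y') := by
    funext κ u
    exact vertexOfK_bsum hK hδ N N' (hT κ u) ν y'
  rw [hin]
  exact vertexOfK_bsum hK hδ N N' (S := fun κ u => vertexOfK K N (T κ u) ν y')
    (fun κ u x z a b => abs_vertexOfK_le hK hδ N (hT κ u) ν y' x z a b) μ y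

/-- [folklore] **LEGS PASS THROUGH `vsym`, DIVERGENCE FORM** (WARD6 (9.1)): `vsym K N (fun s ↦ rdiv (T s)) s = rdiv (vsym K N T s)`. -/
theorem vsym_rdiv (hK : Decays K C δ) (hδ : 0 < δ) (N : ℕ) (hT : ∀ κ u κ' u' x z a b, |T κ u κ' u' x z a b| ≤ B)
    (μ : Fin (d + 1)) (y : Fin (d + 1) → ℤ) (ν : Fin (d + 1)) (y' : Fin (d + 1) → ℤ) :
    vsym K N (fun κ u κ' u' => rdiv (T κ u κ' u')) μ y ν y' = rdiv (vsym K N T μ y ν y') := by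
  simp only [vsym]
  rw [vertex2OfK_rdiv hK hδ N hT, vertex2OfK_rdiv hK hδ N hT, ← rdiv_add, ← rdiv_smul]

/-- [folklore] **LEGS PASS THROUGH `vsym`, BLOCK-SUM FORM**: `vsym K N (fun s ↦ bsum N′ (T s)) s = bsum N′ (vsym K N T s)`. -/
theorem vsym_bsum (hK : Decays K C δ) (hδ : 0 < δ) (N N' : ℕ) (hT : ∀ κ u κ' u' x z a b, |T κ u κ' u' x z a b| ≤ B)
    (μ : Fin (d + 1)) (y : Fin (d + 1) → ℤ) (ν : Fin (d + 1)) (y' : Fin (d + 1) → ℤ) :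
    vsym K N (fun κ u κ' u' => bsum N' (T κ u κ' u')) μ y ν y' = bsum N' (vsym K N T μ y ν y') := by
  simp only [vsym]
  rw [vertex2OfK_bsum hK hδ N N' hT, vertex2OfK_bsum hK hδ N N' hT, ← bsum_add, ← bsum_smul]

/-- [folklore] The two pass-throughs combined on the tower's object `𝔹 Δ = bsum N′ ∘ rdiv`: `vsym K N (fun s ↦ bsum N′ (rdiv (T s))) s = bsum N′ (rdiv (vsym K N T s))`. -/
theorem vsym_bsum_rdiv (hK : Decays K C δ) (hδ : 0 < δ) (N N' : ℕ) (hT : ∀ κ u κ' u' x z a b, |T κ u κ' u' x z a b| ≤ B)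
    (μ : Fin (d + 1)) (y : Fin (d + 1) → ℤ) (ν : Fin (d + 1)) (y' : Fin (d + 1) → ℤ) :
    vsym K N (fun κ u κ' u' => bsum N' (rdiv (T κ u κ' u'))) μ y ν y' = bsum N' (rdiv (vsym K N T μ y ν y')) := by
  rw [vsym_bsum hK hδ N N' (T := fun κ u κ' u' => rdiv (T κ u κ' u'))
      (fun κ u κ' u' x z a b => bdd_rdiv (fun x z a b => hT κ u κ' u' x z a b) x z a b), vsym_rdiv hK hδ N hT]

end PassThrough

/-! ## §3 The left composition by a kernel commutes with `rdiv` and `bsum` (slices summable) -/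

section Comp

variable {K W : MKer (d + 1) (Fib d)}

/-- [folklore] `K ∘ rdiv W = rdiv (K ∘ W)` when the slices `y ↦ Σ_f K x y a f · W y z f b` are summable. -/
theorem comp_rdiv (hs : ∀ x z a b, Summable fun y : Site (d + 1) => ∑ f, K x y a f * W y z f b) :
    comp K (rdiv W) = rdiv (comp K W) := by
  funext x p a b
  have e : ∀ y : Site (d + 1), ∑ f, K x y a f * rdiv W y p f b
      = ∑ β, ((∑ f, K x y a f * W y (p - unitVec β) f (Sum.inl β)) - ∑ f, K x y a f * W y p f (Sum.inl β)) := by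
    intro y
    simp only [rdiv_apply, Finset.mul_sum, mul_sub]
    rw [Finset.sum_comm]
    simp only [Finset.sum_sub_distrib]
  show (∑' y, ∑ f, K x y a f * rdiv W y p f b) = ∑ β, ((∑' y, ∑ f, K x y a f * W y (p - unitVec β) f (Sum.inl β)) - ∑' y, ∑ f, K x y a f * W y p f (Sum.inl β))
  rw [tsum_congr e, Summable.tsum_finsetSum (fun β _ => (hs _ _ _ _).sub (hs _ _ _ _))]
  exact Finset.sum_congr rfl fun β _ => (hs _ _ _ _).tsum_sub (hs _ _ _ _)

/-- [folklore] `K ∘ bsum N W = bsum N (K ∘ W)` when the slices are summable. -/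
theorem comp_bsum (N : ℕ) (hs : ∀ x z a b, Summable fun y : Site (d + 1) => ∑ f, K x y a f * W y z f b) :
    comp K (bsum N W) = bsum N (comp K W) := by
  funext x y' a b
  have e : ∀ y : Site (d + 1), ∑ f, K x y a f * bsum N W y y' f b
      = ∑ v ∈ box (d + 1) N, ∑ f, K x y a f * W y ((N : ℤ) • y' + toSite v) f b := by
    intro y
    simp only [bsum_apply, Finset.mul_sum]
    rw [Finset.sum_comm]
  show (∑' y, ∑ f, K x y a f * bsum N W y y' f b) = ∑ v ∈ box (d + 1) N, ∑' y, ∑ f, K x y a f * W y ((N : ℤ) • y' + toSite v) f b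
  rw [tsum_congr e, Summable.tsum_finsetSum (fun v _ => hs _ _ _ _)]

end Comp

/-! ## §4 The closed one-step identity for the right-divergenced leg of `lin4` -/

section Lin

variable {N : ℕ} {K : MKer (d + 1) (Fib d)} {C δ : ℝ}
  {T : Fin (d + 1) → (Fin (d + 1) → ℤ) → Fin (d + 1) → (Fin (d + 1) → ℤ) → MKer (d + 1) (Fib d)} {B : ℝ} {cH : ℝ}

/-- [folklore] **(REP-leg), THE CLOSED ONE-STEP IDENTITY** (R10 (iii) ∕ WARD6 (9.1), as an equality of `MKer`-valued tables): for a decaying `K` (rate `δ > 0`)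
with (hH) (constant `c_H`) and (hM♯), `N ≥ 1`, a bounded bi-table `T`, any `c` and every slot quadruple `s`:
`rdiv (lin4 c K N T s) = legStep (−(c·c_H)) K K N (fun s ↦ bsum N (rdiv (T s))) s` — the right-divergenced member one level up is the one-step leg map of the
BLOCK-SUMMED right-divergenced member: slots through `vsym`, the left leg through one `K`-row, NO CROSS TERMS (field rows: gen-58's `legDiv_lin4_right_inner`
+ §2 + §3; multiplier rows: both sides vanish, `mmRead_inr_left`). -/
theorem rdiv_lin4 (hK : Decays K C δ) (hδ : 0 < δ) (hN : 1 ≤ N) (c : ℝ) (hT : ∀ κ u κ' u' x z a b, |T κ u κ' u' x z a b| ≤ B)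
    (hH : ∀ (y : Site (d + 1)) (κ : Fin (d + 1)) (u : Site (d + 1)),
      ∑ μ, (colH K N μ (y - unitVec μ) κ u - colH K N μ y κ u) = cH * gaugeWt N y κ u)
    (hMf : ∀ (y x₂ : Site (d + 1)) (ρ : Fin (d + 1)),
      ∑ μ, (K x₂ ((N : ℤ) • (y - unitVec μ)) (Sum.inr ρ) (Sum.inr μ) - K x₂ ((N : ℤ) • y) (Sum.inr ρ) (Sum.inr μ)) = 0)
    (κ : Fin (d + 1)) (u : Site (d + 1)) (κ' : Fin (d + 1)) (u' : Site (d + 1)) :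
    rdiv (lin4 c K N T κ u κ' u') = legStep (-(c * cH)) K K N (fun κ u κ' u' => bsum N (rdiv (T κ u κ' u'))) κ u κ' u' := by
  funext x' y a b
  rcases a with α | ρ
  · -- field rows: the T-EQ right-leg law with the left resolvent pulled out, then the legs pass through `vsym`
    rw [rdiv_apply, legStep_inl, legDiv_lin4_right_inner hK hδ hN c hT hH hMf κ u κ' u' x' α y,
      vsym_bsum_rdiv hK hδ N N hT κ u κ' u']
    simp only [ExpKernelCalculus.comp, bsum_apply, rdiv_apply]
  · -- multiplier rows: `lin4` has none
    rw [rdiv_apply, legStep_inr]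
    refine Finset.sum_eq_zero fun β _ => ?_
    rw [lin4_apply]
    simp only [Pi.neg_apply, Pi.smul_apply, mmRead_inr_left, smul_zero, neg_zero, sub_self]

/-- [folklore] **(REP-leg) WITH SOURCES** — the affine recursion `T′ = lin4 c K N T + F` (leaf-04's `unitS₂_T2Of_succ_affine`) divergenced in the right leg:
`rdiv ((lin4 c K N T + F) s) = legStep (−(c·c_H)) K K N (fun s ↦ bsum N (rdiv (T s))) s + rdiv (F s)` — R10 (iii)'s `Δ_{j+1} = 𝓛_j(𝔹 Δ_j) + D^R F_j`. -/
theorem rdiv_lin4_affine (hK : Decays K C δ) (hδ : 0 < δ) (hN : 1 ≤ N) (c : ℝ) (hT : ∀ κ u κ' u' x z a b, |T κ u κ' u' x z a b| ≤ B)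
    (hH : ∀ (y : Site (d + 1)) (κ : Fin (d + 1)) (u : Site (d + 1)),
      ∑ μ, (colH K N μ (y - unitVec μ) κ u - colH K N μ y κ u) = cH * gaugeWt N y κ u)
    (hMf : ∀ (y x₂ : Site (d + 1)) (ρ : Fin (d + 1)),
      ∑ μ, (K x₂ ((N : ℤ) • (y - unitVec μ)) (Sum.inr ρ) (Sum.inr μ) - K x₂ ((N : ℤ) • y) (Sum.inr ρ) (Sum.inr μ)) = 0)
    (F : Fin (d + 1) → (Fin (d + 1) → ℤ) → Fin (d + 1) → (Fin (d + 1) → ℤ) → MKer (d + 1) (Fib d))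
    (κ : Fin (d + 1)) (u : Site (d + 1)) (κ' : Fin (d + 1)) (u' : Site (d + 1)) :
    rdiv ((lin4 c K N T + F) κ u κ' u')
      = legStep (-(c * cH)) K K N (fun κ u κ' u' => bsum N (rdiv (T κ u κ' u'))) κ u κ' u' + rdiv (F κ u κ' u') := by
  show rdiv (lin4 c K N T κ u κ' u' + F κ u κ' u') = _
  rw [rdiv_add, rdiv_lin4 hK hδ hN c hT hH hMf]

end Lin

/-! ## §5 The block sum commutes with the one-step leg map; the leg map is additive on bounded tables -/

section Commute

variable {N : ℕ} {G K : MKer (d + 1) (Fib d)} {CG δG CK δK : ℝ}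
  {W W' : Fin (d + 1) → (Fin (d + 1) → ℤ) → Fin (d + 1) → (Fin (d + 1) → ℤ) → MKer (d + 1) (Fib d)} {B : ℝ}

/-- [folklore] **`𝔹` COMMUTES WITH `𝓛`** (the position index vs the slots and the left leg): for decaying `G`, `K` and a bounded table `W`,
`bsum N′ (legStep kc G K N W s) = legStep kc G K N (fun s ↦ bsum N′ (W s)) s` — the algebra behind the m-fold form
`𝓛_j𝔹 ⋯ 𝓛_{i+1}𝔹 = (𝓛_j ⋯ 𝓛_{i+1}) ∘ 𝔹^{(j−i)}` of WARD6 (9.1). -/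
theorem bsum_legStep (hG : Decays G CG δG) (hδG : 0 < δG) (hK : Decays K CK δK) (hδK : 0 < δK) (kc : ℝ) (N' : ℕ)
    (hW : ∀ κ u κ' u' x z a b, |W κ u κ' u' x z a b| ≤ B)
    (κ : Fin (d + 1)) (u : Site (d + 1)) (κ' : Fin (d + 1)) (u' : Site (d + 1)) :
    bsum N' (legStep kc G K N W κ u κ' u') = legStep kc G K N (fun κ u κ' u' => bsum N' (W κ u κ' u')) κ u κ' u' := by
  have hV : Bdd (vsym G N W κ u κ' u') _ := fun x z a b => abs_vsym_le hG hδG N hW κ u κ' u' x z a b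
  funext x' y a b
  rcases a with α | ρ
  · rw [bsum_apply, legStep_inl, vsym_bsum hG hδG N N' hW, comp_bsum N' (summable_slices_decays_bdd hK hδK hV), bsum_apply, Finset.mul_sum]
    exact Finset.sum_congr rfl fun v _ => legStep_inl kc G K N W κ u κ' u' x' _ α b
  · rw [bsum_apply, legStep_inr]
    exact Finset.sum_eq_zero fun v _ => legStep_inr kc G K N W κ u κ' u' x' _ ρ b

/-- [folklore] **THE ONE-STEP LEG MAP IS ADDITIVE ON BOUNDED TABLES** (leaf-01's `vsym_add`, then `comp_add_right` on summable slices). -/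
theorem legStep_add (hG : Decays G CG δG) (hδG : 0 < δG) (hK : Decays K CK δK) (hδK : 0 < δK) (kc : ℝ)
    (hW : ∀ κ u κ' u' x z a b, |W κ u κ' u' x z a b| ≤ B) (hW' : ∀ κ u κ' u' x z a b, |W' κ u κ' u' x z a b| ≤ B)
    (κ : Fin (d + 1)) (u : Site (d + 1)) (κ' : Fin (d + 1)) (u' : Site (d + 1)) :
    legStep kc G K N (W + W') κ u κ' u' = legStep kc G K N W κ u κ' u' + legStep kc G K N W' κ u κ' u' := by
  have hV : Bdd (vsym G N W κ u κ' u') _ := fun x z a b => abs_vsym_le hG hδG N hW κ u κ' u' x z a b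
  have hV' : Bdd (vsym G N W' κ u κ' u') _ := fun x z a b => abs_vsym_le hG hδG N hW' κ u κ' u' x z a b
  funext x' y a b
  show legStep kc G K N (W + W') κ u κ' u' x' y a b = legStep kc G K N W κ u κ' u' x' y a b + legStep kc G K N W' κ u κ' u' x' y a b
  rcases a with α | ρ
  · rw [legStep_inl, legStep_inl, legStep_inl, vsym_add hG hδG N hW hW',
      comp_add_right (summable_slices_decays_bdd hK hδK hV) (summable_slices_decays_bdd hK hδK hV')]
    simp only [Pi.add_apply, mul_add]
  · rw [legStep_inr, legStep_inr, legStep_inr, add_zero]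

end Commute

/-! ## §6 The comb ∕ wall instance: the dressed step resolvent `K♮ᴱ_j`, `N = Lc`, `c_H = (Lc^{d+1})⁻¹` -/

section Comb

variable {Lc : ℕ} [NeZero Lc] {r : Fin (d + 1) → ℕ}

/-- [folklore] **(REP-leg) FOR THE DRESSED COMB STEP** (every `j`, every in-block root `r`, every bounded `T`, any `c`; `c_H = (Lc^{d+1})⁻¹` j-free — WARD6 (9.2):
the exact leg laws are the DRESSED chain's): `rdiv (lin4 c K♮ᴱ_j Lc T s) = legStep (−(c·(Lc^{d+1})⁻¹)) K♮ᴱ_j K♮ᴱ_j Lc (fun s ↦ bsum Lc (rdiv (T s))) s`. -/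
theorem rdiv_lin4_comb (hr : r ∈ box (d + 1) Lc) (j : ℕ) (c : ℝ)
    {T : Fin (d + 1) → (Fin (d + 1) → ℤ) → Fin (d + 1) → (Fin (d + 1) → ℤ) → MKer (d + 1) (Fib d)} {B : ℝ}
    (hT : ∀ κ u κ' u' x z a b, |T κ u κ' u' x z a b| ≤ B)
    (κ : Fin (d + 1)) (u : Site (d + 1)) (κ' : Fin (d + 1)) (u' : Site (d + 1)) :
    rdiv (lin4 c (unitK (sfStep Lc j) (smStep d Lc j) (coDressKBmAt (toSite r) Lc (KInvStep (d := d) Lc j))) Lc T κ u κ' u')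
      = legStep (-(c * ((Lc : ℝ) ^ (d + 1))⁻¹))
          (unitK (sfStep Lc j) (smStep d Lc j) (coDressKBmAt (toSite r) Lc (KInvStep (d := d) Lc j)))
          (unitK (sfStep Lc j) (smStep d Lc j) (coDressKBmAt (toSite r) Lc (KInvStep (d := d) Lc j))) Lc
          (fun κ u κ' u' => bsum Lc (rdiv (T κ u κ' u'))) κ u κ' u' := by
  obtain ⟨δK, CK, hδK, -, hG⟩ := decays_coDressKBmAt_KInvStep (d := d) hr j
  exact rdiv_lin4 (decays_unitK hG) hδK (one_le_of_neZero Lc) c hT (hH_unitK_comb hr j) (hM_unitK_comb j) κ u κ' u'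

end Comb

end Summit.QuantumFields.BalabanUV.Beta.GAN24.Lin4LegTower
end
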